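import Mathlib.Analysis.SpecialFunctions.Pow.Real
import Mathlib.Analysis.SpecialFunctions.Log.Deriv
import Mathlib.Analysis.Calculus.MeanValue
import Mathlib.Analysis.PSeries
import HarnessLib

/-!
# The analytic lemma of the OSSS proof of sharpness (Duminil-Copin–Raoufi–Tassion 2019, Lemma 3.1)

CITATION HEADER. Source: H. Duminil-Copin, A. Raoufi, V. Tassion, *Sharp phase transition for the random-cluster and
Potts models via decision trees*, Ann. of Math. 189 (2019) 75–99, §3, Lemma 3.1: "Consider a converging sequence of
increasing differentiable functions `f_n : [β₀, β₁] → [0, M]` satisfying `f_n' ≥ (n/Σ_n)·f_n` for all `n ≥ 1`, where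
`Σ_n = ∑_{k=0}^{n−1} f_k`.  Then there exists `β̃ ∈ [β₀, β₁]` such that: P1 For any `β < β̃`, there exists `c_β > 0` such that
for any `n` large enough, `f_n(β) ≤ exp(−c_β n)`.  P2 For any `β > β̃`, `f = lim f_n` satisfies `f(β) ≥ β − β̃`."  Also:
H. Duminil-Copin, *Sharp threshold phenomena in statistical physics* (arXiv:1810.03384), Lemma 3.1.

What is reproduced, fully proved (`drt_lemma`): the lemma for a family `f : ℕ → ℝ → ℝ` of continuous nondecreasing functions with
values in `[0, M]`, differentiable on the open interval `(α, β₁)` with the DIVISION-FREE inequality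
`c₀ · n · f_n(x) ≤ Σ_n(x) · f_n'(x)` there (a constant `c₀ > 0` is allowed; P2 then reads `f_n(β) ≥ c₀(β − β̃)`), under the two
extra hypotheses that hold in every percolation application and shorten the proof: `f_0 ≥ m₀ > 0` (so `Σ_n > 0`; in percolation
`f_0 = θ_0 = 1`) and `n ↦ f_n(x)` nonincreasing (so `lim f_n = inf f_n` and P2 is stated for every `f_n`).  The threshold is
`β̃ = sup({α} ∪ {β : Σ_n(β) ≤ n^a eventually, for some a < 1})` as in the source; P1 is the two-step Grönwall argument
(stretched-exponential decay from `Σ_n ≤ n^a`, then summability and exponential decay), P2 the `T_n = ∑_{k≤n} f_k/k` argument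
(`T_n' ≥ c₀(log Σ_{n+1} − log M)` by `f_k/Σ_k ≥ log(Σ_{k+1}/Σ_k)`, against `T_n(β) ≤ M(1 + log n₀) + f_{n₀}(β)(1 + log n)`).
Consumer: `OneArmOSSSSharpness.lean` (DRT's Theorem 1.2 for Bernoulli percolation on `ℤ^d` from the one-arm OSSS inequality
`OneArmOSSS.oneArm_deriv_ge`).  Real analysis only.
-/

namespace Literature.Probability.Percolation

namespace DRTLemma

open Finset Filter Topology Set

/-- The partial sums `Σ_n(x) = ∑_{k<n} f_k(x)` of DRT's Lemma 3.1.
[cite: DuminilCopinRaoufiTassion2019, §3 Lemma 3.1 (Σ_n = ∑_{k=0}^{n−1} f_k)] -/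
def psum (f : ℕ → ℝ → ℝ) (n : ℕ) (x : ℝ) : ℝ := ∑ k ∈ Finset.range n, f k x

section

variable {f : ℕ → ℝ → ℝ} {M m₀ : ℝ}

/-- `Σ_n(x) ≥ f_0(x) ≥ m₀` for `n ≥ 1` (nonnegative terms). [cite: DuminilCopinRaoufiTassion2019, §3 Lemma 3.1 (Σ_n ≥ f_0)] -/
theorem le_psum (hnn : ∀ n x, 0 ≤ f n x) (hf0 : ∀ x, m₀ ≤ f 0 x) {n : ℕ} (hn : 1 ≤ n) (x : ℝ) : m₀ ≤ psum f n x := by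
  unfold psum
  obtain ⟨k, rfl⟩ : ∃ k, n = k + 1 := ⟨n - 1, by omega⟩
  rw [Finset.sum_range_succ']
  have h1 : 0 ≤ ∑ i ∈ Finset.range k, f (i + 1) x := Finset.sum_nonneg fun i _ => hnn _ _
  linarith [hf0 x]

/-- `Σ_n` is nondecreasing in `x` when every `f_k` is. [cite: DuminilCopinRaoufiTassion2019, §3 Lemma 3.1 (the f_n are increasing)] -/
theorem psum_mono (hmono : ∀ n, Monotone (f n)) (n : ℕ) : Monotone (psum f n) :=
  fun _ _ hxy => Finset.sum_le_sum fun k _ => hmono k hxy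

/-- `Σ_n ≤ n·M`. [cite: DuminilCopinRaoufiTassion2019, §3 Lemma 3.1 (f_k ≤ M)] -/
theorem psum_le (hle : ∀ n x, f n x ≤ M) (n : ℕ) (x : ℝ) : psum f n x ≤ n * M := by
  unfold psum
  calc ∑ k ∈ Finset.range n, f k x ≤ ∑ k ∈ Finset.range n, M := Finset.sum_le_sum fun k _ => hle k x
    _ = n * M := by rw [Finset.sum_const, Finset.card_range, nsmul_eq_mul]

/-- `Σ_n ≥ 0`. [cite: DuminilCopinRaoufiTassion2019, §3 Lemma 3.1 (f_k ≥ 0)] -/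
theorem psum_nonneg (hnn : ∀ n x, 0 ≤ f n x) (n : ℕ) (x : ℝ) : 0 ≤ psum f n x :=
  Finset.sum_nonneg fun k _ => hnn k x

/-- `Σ_n` is nondecreasing in `n`. [cite: DuminilCopinRaoufiTassion2019, §3 Lemma 3.1 (f_k ≥ 0)] -/
theorem psum_mono_n (hnn : ∀ n x, 0 ≤ f n x) (x : ℝ) : Monotone fun n => psum f n x :=
  fun _ _ hmn => Finset.sum_le_sum_of_subset_of_nonneg (Finset.range_subset_range.2 hmn) fun k _ _ => hnn k x

/-- `Σ_{n+1} = Σ_n + f_n`. [cite: DuminilCopinRaoufiTassion2019, §3 Lemma 3.1 (Σ_{n+1} − Σ_n = f_n)] -/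
theorem psum_succ (n : ℕ) (x : ℝ) : psum f (n + 1) x = psum f n x + f n x := by
  unfold psum; rw [Finset.sum_range_succ]

end

/-! ### Calculus: Grönwall and the mean value inequality -/

/-- Grönwall: if `g` is continuous on `[a, b]`, differentiable on `(a, b)` with `K·g ≤ g'` there, then
`g(a) ≤ g(b)·e^{−(b−a)K}` (the function `r ↦ g(r)e^{−Kr}` is nondecreasing).
[cite: DuminilCopinRaoufiTassion2019, §3 proof of Lemma 3.1 (integrating f_n' ≥ n^{1−a} f_n between β and β')] -/
theorem le_mul_exp_of_mul_le_deriv {g : ℝ → ℝ} {a b K : ℝ} (hab : a ≤ b) (hg : ContinuousOn g (Set.Icc a b))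
    (hd : ∀ x ∈ Set.Ioo a b, DifferentiableAt ℝ g x) (hK : ∀ x ∈ Set.Ioo a b, K * g x ≤ deriv g x) :
    g a ≤ g b * Real.exp (-((b - a) * K)) := by
  have hmono : MonotoneOn (fun r => g r * Real.exp (-K * r)) (Set.Icc a b) := by
    refine monotoneOn_of_deriv_nonneg (convex_Icc a b) (hg.mul (by fun_prop)) ?_ ?_
    · rw [interior_Icc]
      intro x hx
      exact ((hd x hx).mul (by fun_prop)).differentiableWithinAt
    · rw [interior_Icc]
      intro x hx
      have hE : HasDerivAt (fun r => Real.exp (-K * r)) (Real.exp (-K * x) * (-K)) x := by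
        have := ((hasDerivAt_id x).const_mul (-K)).exp
        simpa [mul_comm] using this
      have hfg : (fun r => g r * Real.exp (-K * r)) = g * fun r => Real.exp (-K * r) := rfl
      rw [hfg, ((hd x hx).hasDerivAt.mul hE).deriv]
      have : deriv g x * Real.exp (-K * x) + g x * (Real.exp (-K * x) * -K)
          = Real.exp (-K * x) * (deriv g x - K * g x) := by ring
      rw [this]
      exact mul_nonneg (Real.exp_pos _).le (by linarith [hK x hx])
  have h := hmono ⟨le_rfl, hab⟩ ⟨hab, le_rfl⟩ hab
  simp only at h
  have heq : g b * Real.exp (-((b - a) * K)) = g b * Real.exp (-K * b) * Real.exp (K * a) := by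
    rw [mul_assoc, ← Real.exp_add]; congr 1; ring
  have h2 : g a = g a * Real.exp (-K * a) * Real.exp (K * a) := by
    rw [mul_assoc, ← Real.exp_add]; simp
  rw [heq, h2]
  exact mul_le_mul_of_nonneg_right h (Real.exp_pos _).le

/-- `∑_{k=1}^{n} 1/k ≤ 1 + log n` for `n ≥ 1`. [folklore] -/
private theorem sum_Icc_inv_le_one_add_log {n : ℕ} (hn : 1 ≤ n) :
    ∑ k ∈ Finset.Icc 1 n, (1 : ℝ) / k ≤ 1 + Real.log n := by
  induction n with
  | zero => omega
  | succ m ih =>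
    rcases Nat.eq_zero_or_pos m with rfl | hm
    · simp
    · rw [Finset.sum_Icc_succ_top (by omega), Nat.cast_succ]
      have ih' := ih hm
      have hm' : (0 : ℝ) < m := by exact_mod_cast hm
      -- `1/(m+1) ≤ log(m+1) − log m`
      have hstep : (1 : ℝ) / (m + 1) ≤ Real.log (m + 1) - Real.log m := by
        have h := Real.one_sub_inv_le_log_of_pos (show (0 : ℝ) < (m + 1) / m by positivity)
        rw [Real.log_div (by positivity) hm'.ne', inv_div] at h
        have : (1 : ℝ) - m / (m + 1) = 1 / (m + 1) := by field_simp; ring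
        linarith
      linarith

/-- Stretched exponentials are dominated by inverse squares: for `0 < b`, `0 < c` there is `A` with
`exp(−c·k^b) ≤ A/k²` for all `k ≥ 1` (`e^{y} ≥ y^m/m!` with `bm ≥ 2`).
[cite: DuminilCopinRaoufiTassion2019, §3 proof of Lemma 3.1 (summing the stretched-exponential bound: Σ_n(β'') bounded)] -/
theorem exists_exp_neg_rpow_le {b c : ℝ} (hb : 0 < b) (hc : 0 < c) :
    ∃ A : ℝ, 0 < A ∧ ∀ k : ℕ, 1 ≤ k → Real.exp (-(c * (k : ℝ) ^ b)) ≤ A / (k : ℝ) ^ 2 := by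
  obtain ⟨m, hm⟩ : ∃ m : ℕ, 2 ≤ b * m := by
    refine ⟨⌈2 / b⌉₊, ?_⟩
    have h := Nat.le_ceil (2 / b)
    calc (2 : ℝ) = b * (2 / b) := by field_simp
      _ ≤ b * ⌈2 / b⌉₊ := mul_le_mul_of_nonneg_left h hb.le
  refine ⟨(m.factorial : ℝ) / c ^ m, by positivity, fun k hk => ?_⟩
  have hk' : (1 : ℝ) ≤ k := by exact_mod_cast hk
  have hk0 : (0 : ℝ) < k := by linarith
  set y : ℝ := c * (k : ℝ) ^ b with hy
  have hy0 : 0 < y := by positivity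
  -- `y^m/m! ≤ e^y`, so `e^{-y} ≤ m!/y^m`
  have h1 : y ^ m / m.factorial ≤ Real.exp y := Real.pow_div_factorial_le_exp y hy0.le m
  have hfac : (0 : ℝ) < m.factorial := by exact_mod_cast Nat.factorial_pos m
  have h2 : Real.exp (-y) ≤ m.factorial / y ^ m := by
    rw [Real.exp_neg, inv_eq_one_div, div_le_div_iff₀ (Real.exp_pos y) (by positivity)]
    rw [div_le_iff₀ hfac] at h1
    linarith
  -- `y^m = c^m k^{bm} ≥ c^m k^2`
  have h3 : c ^ m * (k : ℝ) ^ 2 ≤ y ^ m := by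
    rw [hy, mul_pow, ← Real.rpow_natCast ((k : ℝ) ^ b) m, ← Real.rpow_mul hk0.le]
    refine mul_le_mul_of_nonneg_left ?_ (by positivity)
    calc (k : ℝ) ^ 2 = (k : ℝ) ^ ((2 : ℕ) : ℝ) := (Real.rpow_natCast _ 2).symm
      _ ≤ (k : ℝ) ^ (b * m) := Real.rpow_le_rpow_of_exponent_le hk' (by push_cast; linarith)
  calc Real.exp (-(c * (k : ℝ) ^ b)) = Real.exp (-y) := by rw [hy]
    _ ≤ m.factorial / y ^ m := h2
    _ ≤ m.factorial / (c ^ m * (k : ℝ) ^ 2) := div_le_div_of_nonneg_left hfac.le (by positivity) h3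
    _ = m.factorial / c ^ m / (k : ℝ) ^ 2 := by rw [div_div]

/-- `∑_{1 ≤ k < n} 1/k² ≤ 2`. [folklore] -/
private theorem sum_inv_sq_le_two (n : ℕ) : ∑ k ∈ Finset.Ico 1 n, 1 / (k : ℝ) ^ 2 ≤ 2 := by
  rcases Nat.lt_or_ge n 2 with hn | hn
  · interval_cases n <;> simp
  · have h := sum_Ioo_inv_sq_le (α := ℝ) 0 n
    have hIoo : Finset.Ioo 0 n = Finset.Ico 1 n := by ext k; simp [Finset.mem_Ioo, Finset.mem_Ico]; omega
    rw [hIoo] at h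
    have h' : ∑ k ∈ Finset.Ico 1 n, ((k : ℝ) ^ 2)⁻¹ ≤ 2 := by simpa using h
    calc ∑ k ∈ Finset.Ico 1 n, 1 / (k : ℝ) ^ 2 = ∑ k ∈ Finset.Ico 1 n, ((k : ℝ) ^ 2)⁻¹ :=
          Finset.sum_congr rfl fun k _ => one_div _
      _ ≤ 2 := h'

/-- Telescoping over `Icc 1 n`: `∑_{k=1}^{n} (g(k+1) − g(k)) = g(n+1) − g(1)`. [folklore] -/
private theorem sum_Icc_sub_telescope (g : ℕ → ℝ) (n : ℕ) :
    ∑ k ∈ Finset.Icc 1 n, (g (k + 1) - g k) = g (n + 1) - g 1 := by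
  induction n with
  | zero => simp
  | succ m ih => rw [Finset.sum_Icc_succ_top (by omega), ih]; ring

section Main

variable {f : ℕ → ℝ → ℝ} {α β₁ M m₀ c₀ : ℝ}

/-- **P1 engine.** If `Σ_n(β') ≤ n^a` for `n ≥ N` with `a < 1`, then for every `β ∈ [α, β')` (`β' ≤ β₁`) there is `c > 0` with
`f_n(β) ≤ M e^{−cn}` for all `n ≥ 1`: Grönwall with `K = c₀n^{1−a}` on `[β'', β']` gives `f_n(β'') ≤ Me^{−c₁n^{1−a}}`, hence
`Σ_n(β'')` is bounded (`≤ B`), and Grönwall with `K = c₀n/B` on `[β, β'']` gives the exponential bound.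
[cite: DuminilCopinRaoufiTassion2019, §3 proof of Lemma 3.1, P1 ("f_n(β) ≤ M exp(−c n^{1−a}) … Σ_n(β'') ≤ Σ … f_n' ≥ (n/Σ) f_n")] -/
theorem exp_decay_of_psum_le_rpow (hM : 0 < M) (hm₀ : 0 < m₀) (hc₀ : 0 < c₀)
    (hcont : ∀ n, Continuous (f n)) (hdiff : ∀ n, ∀ x ∈ Ioo α β₁, DifferentiableAt ℝ (f n) x)
    (hmono : ∀ n, Monotone (f n)) (hnn : ∀ n x, 0 ≤ f n x) (hle : ∀ n x, f n x ≤ M) (hf0 : ∀ x, m₀ ≤ f 0 x)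
    (hineq : ∀ n, 1 ≤ n → ∀ x ∈ Ioo α β₁, c₀ * n * f n x ≤ psum f n x * deriv (f n) x)
    {β β' a : ℝ} {N : ℕ} (hαβ : α ≤ β) (hββ' : β < β') (hβ'1 : β' ≤ β₁) (ha : a < 1)
    (hgood : ∀ n, N ≤ n → psum f n β' ≤ (n : ℝ) ^ a) :
    ∃ c : ℝ, 0 < c ∧ ∀ n, 1 ≤ n → f n β ≤ M * Real.exp (-(c * n)) := by
  set β'' : ℝ := (β + β') / 2 with hβ''
  have h1 : β < β'' := by rw [hβ'']; linarith
  have h2 : β'' < β' := by rw [hβ'']; linarith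
  -- derivative lower bound `K f_n ≤ f_n'` from a bound `Σ_n(x) ≤ P` on an interval
  have hderiv : ∀ {n : ℕ} (hn : 1 ≤ n) {u v P : ℝ} (hαu : α ≤ u) (hv : v ≤ β₁) (hP : 0 < P)
      (hPs : ∀ x ∈ Ioo u v, psum f n x ≤ P),
      ∀ x ∈ Ioo u v, c₀ * n / P * f n x ≤ deriv (f n) x := by
    intro n hn u v P hαu hv hP hPs x hx
    have hxI : x ∈ Ioo α β₁ := ⟨lt_of_le_of_lt hαu hx.1, lt_of_lt_of_le hx.2 hv⟩
    have hi := hineq n hn x hxI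
    have hS0 : 0 < psum f n x := lt_of_lt_of_le hm₀ (le_psum hnn hf0 hn x)
    have hfx : 0 ≤ f n x := hnn n x
    -- `deriv ≥ c₀ n f / Σ ≥ c₀ n f / P`
    have hD : c₀ * n * f n x / psum f n x ≤ deriv (f n) x := by
      rw [div_le_iff₀ hS0]; linarith
    have hD0 : 0 ≤ c₀ * n * f n x := by positivity
    calc c₀ * n / P * f n x = c₀ * n * f n x / P := by ring
      _ ≤ c₀ * n * f n x / psum f n x := div_le_div_of_nonneg_left hD0 hS0 (hPs x hx)
      _ ≤ deriv (f n) x := hD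
  -- Step 1: stretched-exponential bound at `β''` for `n ≥ max N 1`
  set c₁ : ℝ := (β' - β'') * c₀ with hc₁
  have hc₁0 : 0 < c₁ := by rw [hc₁]; exact mul_pos (by linarith) hc₀
  have step1 : ∀ n : ℕ, N ≤ n → 1 ≤ n → f n β'' ≤ M * Real.exp (-(c₁ * (n : ℝ) ^ (1 - a))) := by
    intro n hNn hn
    have hn0 : (0 : ℝ) < n := by exact_mod_cast hn
    have hP : 0 < (n : ℝ) ^ a := Real.rpow_pos_of_pos hn0 a
    have hK := hderiv hn (u := β'') (v := β') (by linarith) hβ'1 hP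
      (fun x hx => (psum_mono hmono n hx.2.le).trans (hgood n hNn))
    have hG := le_mul_exp_of_mul_le_deriv h2.le (hcont n).continuousOn
      (fun x hx => hdiff n x ⟨by linarith [hx.1], lt_of_lt_of_le hx.2 hβ'1⟩) hK
    have hKeq : (β' - β'') * (c₀ * n / (n : ℝ) ^ a) = c₁ * (n : ℝ) ^ (1 - a) := by
      rw [hc₁, Real.rpow_sub hn0, Real.rpow_one]; ring
    rw [hKeq] at hG
    exact hG.trans (mul_le_mul_of_nonneg_right (hle n β') (Real.exp_pos _).le)
  -- Step 2: `Σ_n(β'') ≤ B` for all `n`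
  obtain ⟨A, hA, hAk⟩ := exists_exp_neg_rpow_le (b := 1 - a) (c := c₁) (by linarith) hc₁0
  set B : ℝ := (N + 1) * M + M * A * 2 with hB
  have hB0 : 0 < B := by positivity
  have step2 : ∀ n, psum f n β'' ≤ B := by
    intro n
    unfold psum
    rcases le_or_gt n (N + 1) with hn | hn
    · calc ∑ k ∈ Finset.range n, f k β'' ≤ ∑ k ∈ Finset.range n, M := Finset.sum_le_sum fun k _ => hle k _
        _ = n * M := by rw [Finset.sum_const, Finset.card_range, nsmul_eq_mul]
        _ ≤ (N + 1) * M := by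
            have : (n : ℝ) ≤ N + 1 := by exact_mod_cast hn
            exact mul_le_mul_of_nonneg_right this hM.le
        _ ≤ B := by rw [hB]; linarith [mul_nonneg (mul_nonneg hM.le hA.le) zero_le_two]
    · rw [← Finset.sum_range_add_sum_Ico _ hn.le]
      have hhead : ∑ k ∈ Finset.range (N + 1), f k β'' ≤ (N + 1) * M := by
        calc ∑ k ∈ Finset.range (N + 1), f k β'' ≤ ∑ k ∈ Finset.range (N + 1), M :=
              Finset.sum_le_sum fun k _ => hle k _
          _ = (N + 1) * M := by rw [Finset.sum_const, Finset.card_range, nsmul_eq_mul]; push_cast; ring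
      have htail : ∑ k ∈ Finset.Ico (N + 1) n, f k β'' ≤ M * A * 2 := by
        calc ∑ k ∈ Finset.Ico (N + 1) n, f k β''
            ≤ ∑ k ∈ Finset.Ico (N + 1) n, M * A * (1 / (k : ℝ) ^ 2) := by
              refine Finset.sum_le_sum fun k hk => ?_
              rw [Finset.mem_Ico] at hk
              have hk1 : 1 ≤ k := by omega
              calc f k β'' ≤ M * Real.exp (-(c₁ * (k : ℝ) ^ (1 - a))) := step1 k (by omega) hk1
                _ ≤ M * (A / (k : ℝ) ^ 2) := mul_le_mul_of_nonneg_left (hAk k hk1) hM.le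
                _ = M * A * (1 / (k : ℝ) ^ 2) := by ring
          _ = M * A * ∑ k ∈ Finset.Ico (N + 1) n, 1 / (k : ℝ) ^ 2 := by rw [Finset.mul_sum]
          _ ≤ M * A * 2 := by
              refine mul_le_mul_of_nonneg_left ?_ (by positivity)
              calc ∑ k ∈ Finset.Ico (N + 1) n, 1 / (k : ℝ) ^ 2 ≤ ∑ k ∈ Finset.Ico 1 n, 1 / (k : ℝ) ^ 2 :=
                    Finset.sum_le_sum_of_subset_of_nonneg (Finset.Ico_subset_Ico (by omega) le_rfl)
                      fun k _ _ => by positivity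
                _ ≤ 2 := sum_inv_sq_le_two n
      rw [hB]; linarith
  -- Step 3: exponential bound at `β`
  refine ⟨(β'' - β) * c₀ / B, by positivity, fun n hn => ?_⟩
  have hK := hderiv hn (u := β) (v := β'') hαβ (by linarith) hB0
    (fun x hx => (psum_mono hmono n hx.2.le).trans (step2 n))
  have hG := le_mul_exp_of_mul_le_deriv h1.le (hcont n).continuousOn
    (fun x hx => hdiff n x ⟨lt_of_le_of_lt hαβ hx.1, by linarith [hx.2]⟩) hK
  have hKeq : (β'' - β) * (c₀ * n / B) = (β'' - β) * c₀ / B * n := by ring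
  rw [hKeq] at hG
  exact hG.trans (mul_le_mul_of_nonneg_right (hle n β'') (Real.exp_pos _).le)

/-- **P2 engine.** If for every `a < 1` the bound `Σ_n(γ) ≤ n^a` fails for infinitely many `n`, then for every
`β ∈ (γ, β₁]` and every `n`: `f_n(β) ≥ c₀(β − γ)`.  The function `T_n = ∑_{k=1}^{n} f_k/k` has
`T_n' ≥ c₀(log Σ_{n+1}(γ) − log M)` on `(γ, β)` (from `f_k/Σ_k ≥ log(Σ_{k+1}/Σ_k)`), while
`T_n(β) ≤ M(1 + log n₀) + f_{n₀}(β)(1 + log n)`.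
[cite: DuminilCopinRaoufiTassion2019, §3 proof of Lemma 3.1, P2 (T_n = (1/log n)∑ f_k/k, T_n' ≥ (log Σ_{n+1} − log M)/log n)] -/
theorem le_of_psum_not_le_rpow (hM : 0 < M) (hm₀ : 0 < m₀) (hc₀ : 0 < c₀)
    (hcont : ∀ n, Continuous (f n)) (hdiff : ∀ n, ∀ x ∈ Ioo α β₁, DifferentiableAt ℝ (f n) x)
    (hmono : ∀ n, Monotone (f n)) (hnn : ∀ n x, 0 ≤ f n x) (hle : ∀ n x, f n x ≤ M) (hf0 : ∀ x, m₀ ≤ f 0 x)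
    (hanti : ∀ x, Antitone (fun n => f n x))
    (hineq : ∀ n, 1 ≤ n → ∀ x ∈ Ioo α β₁, c₀ * n * f n x ≤ psum f n x * deriv (f n) x)
    {γ β : ℝ} (hαγ : α ≤ γ) (hγβ : γ < β) (hβ1 : β ≤ β₁)
    (hbad : ∀ a : ℝ, a < 1 → ∀ N : ℕ, ∃ n, N ≤ n ∧ (n : ℝ) ^ a < psum f n γ) :
    ∀ n, c₀ * (β - γ) ≤ f n β := by
  by_contra hcon
  push Not at hcon
  obtain ⟨n₀, hn₀⟩ := hcon
  set L : ℝ := f n₀ β with hL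
  have hL0 : 0 ≤ L := hnn n₀ β
  set δ : ℝ := c₀ * (β - γ) - L with hδ
  have hδ0 : 0 < δ := by rw [hδ]; linarith
  have hcβγ : 0 < c₀ * (β - γ) := mul_pos hc₀ (by linarith)
  set a : ℝ := 1 - δ / (4 * (c₀ * (β - γ))) with ha
  have h4pos : 0 < 4 * (c₀ * (β - γ)) := by linarith
  have hq : 0 < δ / (4 * (c₀ * (β - γ))) := div_pos hδ0 h4pos
  have ha1 : a < 1 := by rw [ha]; linarith
  have hgap : c₀ * (β - γ) * a - L = 3 * δ / 4 := by
    have hne : β - γ ≠ 0 := ne_of_gt (by linarith)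
    have hne' : c₀ ≠ 0 := hc₀.ne'
    have e1 : c₀ * (β - γ) * a = c₀ * (β - γ) - δ / 4 := by
      rw [ha]; field_simp
    rw [e1, hδ]; ring
  -- the constant part of the bound
  set C₀ : ℝ := M * (1 + Real.log (n₀ + 1)) + L + c₀ * (β - γ) * Real.log M with hC₀
  -- choose a bad `n` with `log n` large
  obtain ⟨Nr, hNr⟩ : ∃ Nr : ℕ, ∀ n : ℕ, Nr ≤ n → C₀ + 1 ≤ 3 * δ / 4 * Real.log n := by
    have ht : Tendsto (fun n : ℕ => 3 * δ / 4 * Real.log n) atTop atTop :=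
      (Real.tendsto_log_atTop.comp tendsto_natCast_atTop_atTop).const_mul_atTop (by positivity)
    obtain ⟨Nr, hNr⟩ := (ht.eventually_ge_atTop (C₀ + 1)).exists_forall_of_atTop
    exact ⟨Nr, hNr⟩
  obtain ⟨n, hn, hbadn⟩ := hbad a ha1 (max Nr (max n₀ 2))
  have hnNr : Nr ≤ n := le_trans (le_max_left _ _) hn
  have hnn₀ : n₀ ≤ n := le_trans ((le_max_left _ _).trans (le_max_right _ _)) hn
  have hn2 : 2 ≤ n := le_trans ((le_max_right _ _).trans (le_max_right _ _)) hn
  have hn1 : 1 ≤ n := by omega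
  have hnr : (2 : ℝ) ≤ n := by exact_mod_cast hn2
  have hlogn0 : 0 ≤ Real.log n := Real.log_nonneg (by linarith)
  -- `T_n` and its derivative
  set T : ℝ → ℝ := fun x => ∑ k ∈ Finset.Icc 1 n, f k x / k with hT
  have hS0 : ∀ {k : ℕ}, 1 ≤ k → ∀ x, 0 < psum f k x :=
    fun hk x => lt_of_lt_of_le hm₀ (le_psum hnn hf0 hk x)
  -- derivative bound on `(γ, β)`
  set m : ℝ := c₀ * (Real.log (psum f (n + 1) γ) - Real.log M) with hm
  have hTderiv : ∀ x ∈ interior (Icc γ β), m ≤ deriv T x := by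
    rw [interior_Icc]
    intro x hx
    have hxI : x ∈ Ioo α β₁ := ⟨lt_of_le_of_lt hαγ hx.1, lt_of_lt_of_le hx.2 hβ1⟩
    have hTd : HasDerivAt T (∑ k ∈ Finset.Icc 1 n, deriv (f k) x / k) x := by
      have : T = fun y => ∑ k ∈ Finset.Icc 1 n, f k y / k := rfl
      rw [this]
      exact HasDerivAt.fun_sum fun k _ => ((hdiff k x hxI).hasDerivAt).div_const _
    rw [hTd.deriv]
    -- termwise: `deriv f_k / k ≥ c₀ f_k / Σ_k ≥ c₀ (log Σ_{k+1} − log Σ_k)`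
    have hterm : ∀ k ∈ Finset.Icc 1 n,
        c₀ * (Real.log (psum f (k + 1) x) - Real.log (psum f k x)) ≤ deriv (f k) x / k := by
      intro k hk
      rw [Finset.mem_Icc] at hk
      have hk1 : 1 ≤ k := hk.1
      have hk0 : (0 : ℝ) < k := by exact_mod_cast hk1
      have hSk := hS0 hk1 x
      have hi := hineq k hk1 x hxI
      -- `deriv f_k / k ≥ c₀ f_k / Σ_k`
      have h1 : c₀ * f k x / psum f k x ≤ deriv (f k) x / k := by
        rw [div_le_div_iff₀ hSk hk0]; linarith
      -- `f_k/Σ_k ≥ log(Σ_{k+1}/Σ_k)`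
      have h2 : Real.log (psum f (k + 1) x) - Real.log (psum f k x) ≤ f k x / psum f k x := by
        rw [← Real.log_div (hS0 (by omega) x).ne' hSk.ne', psum_succ]
        have h := Real.log_le_sub_one_of_pos (show 0 < (psum f k x + f k x) / psum f k x by
          have := hnn k x; positivity)
        have : (psum f k x + f k x) / psum f k x - 1 = f k x / psum f k x := by field_simp; ring
        linarith
      calc c₀ * (Real.log (psum f (k + 1) x) - Real.log (psum f k x)) ≤ c₀ * (f k x / psum f k x) :=
            mul_le_mul_of_nonneg_left h2 hc₀.le
        _ = c₀ * f k x / psum f k x := by ring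
        _ ≤ deriv (f k) x / k := h1
    have hsum := Finset.sum_le_sum hterm
    -- telescope
    have htel : ∑ k ∈ Finset.Icc 1 n, c₀ * (Real.log (psum f (k + 1) x) - Real.log (psum f k x))
        = c₀ * (Real.log (psum f (n + 1) x) - Real.log (psum f 1 x)) := by
      rw [← Finset.mul_sum, sum_Icc_sub_telescope (fun k => Real.log (psum f k x)) n]
    rw [htel] at hsum
    -- `Σ_{n+1}(x) ≥ Σ_{n+1}(γ)`, `Σ_1(x) = f_0(x) ≤ M`
    have hx1 : psum f 1 x ≤ M := by unfold psum; simp [hle 0 x]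
    have hx1pos : 0 < psum f 1 x := hS0 le_rfl x
    have hmon : psum f (n + 1) γ ≤ psum f (n + 1) x := psum_mono hmono (n + 1) hx.1.le
    have hSγ : 0 < psum f (n + 1) γ := hS0 (by omega) γ
    have hlog1 : Real.log (psum f (n + 1) γ) ≤ Real.log (psum f (n + 1) x) := Real.log_le_log hSγ hmon
    have hlog2 : Real.log (psum f 1 x) ≤ Real.log M := Real.log_le_log hx1pos hx1
    calc m = c₀ * (Real.log (psum f (n + 1) γ) - Real.log M) := rfl
      _ ≤ c₀ * (Real.log (psum f (n + 1) x) - Real.log (psum f 1 x)) :=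
          mul_le_mul_of_nonneg_left (by linarith) hc₀.le
      _ ≤ _ := hsum
  -- mean value inequality on `[γ, β]`
  have hTcont : ContinuousOn T (Icc γ β) :=
    (continuous_finsetSum _ fun k _ => (hcont k).div_const _).continuousOn
  have hTdiff : DifferentiableOn ℝ T (interior (Icc γ β)) := by
    rw [interior_Icc]
    intro x hx
    have hxI : x ∈ Ioo α β₁ := ⟨lt_of_le_of_lt hαγ hx.1, lt_of_lt_of_le hx.2 hβ1⟩
    exact (HasDerivAt.fun_sum (u := Finset.Icc 1 n) (A := fun k y => f k y / (k : ℝ))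
      fun k _ => ((hdiff k x hxI).hasDerivAt).div_const _).differentiableAt.differentiableWithinAt
  have hMVT := (convex_Icc γ β).mul_sub_le_image_sub_of_le_deriv hTcont hTdiff hTderiv γ
    (left_mem_Icc.2 hγβ.le) β (right_mem_Icc.2 hγβ.le) hγβ.le
  -- `T γ ≥ 0`
  have hTγ : 0 ≤ T γ := Finset.sum_nonneg fun k _ => div_nonneg (hnn k γ) (Nat.cast_nonneg k)
  -- `T β ≤ M (1 + log(n₀+1)) + L (1 + log n)`
  have hTβ : T β ≤ M * (1 + Real.log (n₀ + 1)) + L * (1 + Real.log n) := by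
    have hsplit : T β = ∑ k ∈ Finset.Icc 1 n, f k β / k := rfl
    rw [hsplit]
    have hIcc : Finset.Icc 1 n = Finset.Icc 1 n₀ ∪ Finset.Ioc n₀ n := by
      ext k; simp [Finset.mem_Icc, Finset.mem_Ioc]; omega
    have hdisj : Disjoint (Finset.Icc 1 n₀) (Finset.Ioc n₀ n) := by
      rw [Finset.disjoint_left]; intro k hk hk'; simp [Finset.mem_Icc, Finset.mem_Ioc] at hk hk'; omega
    rw [hIcc, Finset.sum_union hdisj]
    have hA : ∑ k ∈ Finset.Icc 1 n₀, f k β / k ≤ M * (1 + Real.log (n₀ + 1)) := by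
      calc ∑ k ∈ Finset.Icc 1 n₀, f k β / k ≤ ∑ k ∈ Finset.Icc 1 n₀, M * (1 / (k : ℝ)) :=
            Finset.sum_le_sum fun k hk => by
              rw [Finset.mem_Icc] at hk
              have hk0 : (0 : ℝ) < k := by exact_mod_cast hk.1
              rw [mul_one_div]; exact div_le_div_of_nonneg_right (hle k β) hk0.le
        _ = M * ∑ k ∈ Finset.Icc 1 n₀, 1 / (k : ℝ) := by rw [Finset.mul_sum]
        _ ≤ M * (1 + Real.log (n₀ + 1)) := by
            refine mul_le_mul_of_nonneg_left ?_ hM.le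
            rcases Nat.eq_zero_or_pos n₀ with h0 | h0
            · rw [h0]; simp
            · calc ∑ k ∈ Finset.Icc 1 n₀, 1 / (k : ℝ) ≤ 1 + Real.log n₀ := sum_Icc_inv_le_one_add_log h0
                _ ≤ 1 + Real.log (n₀ + 1) := by
                    have : (0 : ℝ) < n₀ := by exact_mod_cast h0
                    linarith [Real.log_le_log this (by linarith : (n₀ : ℝ) ≤ n₀ + 1)]
    have hBsum : ∑ k ∈ Finset.Ioc n₀ n, f k β / k ≤ L * (1 + Real.log n) := by
      calc ∑ k ∈ Finset.Ioc n₀ n, f k β / k ≤ ∑ k ∈ Finset.Ioc n₀ n, L * (1 / (k : ℝ)) :=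
            Finset.sum_le_sum fun k hk => by
              rw [Finset.mem_Ioc] at hk
              have hk0 : (0 : ℝ) < k := by exact_mod_cast (show 0 < k by omega)
              rw [mul_one_div]
              exact div_le_div_of_nonneg_right (hanti β hk.1.le) hk0.le
        _ = L * ∑ k ∈ Finset.Ioc n₀ n, 1 / (k : ℝ) := by rw [Finset.mul_sum]
        _ ≤ L * (1 + Real.log n) := by
            refine mul_le_mul_of_nonneg_left ?_ hL0
            calc ∑ k ∈ Finset.Ioc n₀ n, 1 / (k : ℝ) ≤ ∑ k ∈ Finset.Icc 1 n, 1 / (k : ℝ) :=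
                  Finset.sum_le_sum_of_subset_of_nonneg (fun k hk => by
                    simp [Finset.mem_Ioc, Finset.mem_Icc] at hk ⊢; omega) fun k _ _ => by positivity
              _ ≤ 1 + Real.log n := sum_Icc_inv_le_one_add_log hn1
    linarith
  -- `log Σ_{n+1}(γ) > a log n`
  have hSn : (n : ℝ) ^ a < psum f (n + 1) γ := hbadn.trans_le (psum_mono_n hnn γ (Nat.le_succ n))
  have hlogS : a * Real.log n < Real.log (psum f (n + 1) γ) := by
    have hna : 0 < (n : ℝ) ^ a := Real.rpow_pos_of_pos (by linarith) a
    have := Real.log_lt_log hna hSn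
    rwa [Real.log_rpow (by linarith)] at this
  -- combine
  have hm_lower : c₀ * (a * Real.log n - Real.log M) ≤ m :=
    mul_le_mul_of_nonneg_left (by linarith) hc₀.le
  have hkey : m * (β - γ) ≤ M * (1 + Real.log (n₀ + 1)) + L * (1 + Real.log n) := by linarith
  have hfinal : 3 * δ / 4 * Real.log n ≤ C₀ := by
    have h1 : c₀ * (a * Real.log n - Real.log M) * (β - γ) ≤ M * (1 + Real.log (n₀ + 1)) + L * (1 + Real.log n) :=
      (mul_le_mul_of_nonneg_right hm_lower (by linarith)).trans hkey
    have h2 : (c₀ * (β - γ) * a - L) * Real.log n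
        ≤ M * (1 + Real.log (n₀ + 1)) + L + c₀ * (β - γ) * Real.log M := by nlinarith
    rw [hgap] at h2
    rw [hC₀]; exact h2
  have := hNr n hnNr
  linarith

/-- **DRT'S LEMMA 3.1** (with a constant `c₀`, for a nonincreasing-in-`n` family bounded below by `m₀ > 0` at `n = 0`).
Let `f_n : ℝ → [0, M]` be continuous and nondecreasing, differentiable on `(α, β₁)` with
`c₀·n·f_n ≤ Σ_n·f_n'` there (`Σ_n = ∑_{k<n} f_k`), `f_0 ≥ m₀ > 0`, `n ↦ f_n(x)` nonincreasing.  Then there is `β̃ ∈ [α, β₁]` with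
(P1) for every `β ∈ [α, β̃)` some `c > 0` such that `f_n(β) ≤ M e^{−cn}` for all `n ≥ 1`, and
(P2) for every `β ∈ (β̃, β₁]` and every `n`, `f_n(β) ≥ c₀(β − β̃)` (so `lim f_n(β) ≥ c₀(β − β̃)`).
[cite: DuminilCopinRaoufiTassion2019, §3 Lemma 3.1 (P1, P2)] -/
theorem drt_lemma (hαβ₁ : α ≤ β₁) (hM : 0 < M) (hm₀ : 0 < m₀) (hc₀ : 0 < c₀)
    (hcont : ∀ n, Continuous (f n)) (hdiff : ∀ n, ∀ x ∈ Ioo α β₁, DifferentiableAt ℝ (f n) x)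
    (hmono : ∀ n, Monotone (f n)) (hnn : ∀ n x, 0 ≤ f n x) (hle : ∀ n x, f n x ≤ M) (hf0 : ∀ x, m₀ ≤ f 0 x)
    (hanti : ∀ x, Antitone (fun n => f n x))
    (hineq : ∀ n, 1 ≤ n → ∀ x ∈ Ioo α β₁, c₀ * n * f n x ≤ psum f n x * deriv (f n) x) :
    ∃ βc ∈ Icc α β₁,
      (∀ β ∈ Ico α βc, ∃ c : ℝ, 0 < c ∧ ∀ n, 1 ≤ n → f n β ≤ M * Real.exp (-(c * n))) ∧
      (∀ β ∈ Ioc βc β₁, ∀ n, c₀ * (β - βc) ≤ f n β) := by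
  -- the good set and the threshold
  set S : Set ℝ := {x | x ∈ Icc α β₁ ∧ (x = α ∨ ∃ a : ℝ, a < 1 ∧ ∃ N : ℕ, ∀ n, N ≤ n → psum f n x ≤ (n : ℝ) ^ a)}
    with hS
  have hαS : α ∈ S := ⟨⟨le_rfl, hαβ₁⟩, Or.inl rfl⟩
  have hSne : S.Nonempty := ⟨α, hαS⟩
  have hSbdd : BddAbove S := ⟨β₁, fun x hx => hx.1.2⟩
  set βc : ℝ := sSup S with hβc
  have hβc1 : βc ≤ β₁ := csSup_le hSne fun x hx => hx.1.2
  have hβc0 : α ≤ βc := le_csSup hSbdd hαS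
  refine ⟨βc, ⟨hβc0, hβc1⟩, ?_, ?_⟩
  · -- P1
    intro β hβ
    obtain ⟨s, hsS, hβs⟩ := exists_lt_of_lt_csSup hSne hβ.2
    have hsα : s ≠ α := by intro h; rw [h] at hβs; linarith [hβ.1]
    rcases hsS.2 with h | ⟨a, ha, N, hN⟩
    · exact absurd h hsα
    · exact exp_decay_of_psum_le_rpow hM hm₀ hc₀ hcont hdiff hmono hnn hle hf0 hineq hβ.1 hβs hsS.1.2 ha hN
  · -- P2
    intro β hβ n
    -- for every `γ ∈ (βc, β)`: `f n β ≥ c₀ (β − γ)`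
    have key : ∀ γ : ℝ, βc < γ → γ < β → c₀ * (β - γ) ≤ f n β := by
      intro γ hγ1 hγ2
      have hγS : γ ∉ S := fun h => not_lt.2 (le_csSup hSbdd h) hγ1
      have hbad : ∀ a : ℝ, a < 1 → ∀ N : ℕ, ∃ m, N ≤ m ∧ (m : ℝ) ^ a < psum f m γ := by
        intro a ha N
        by_contra hno
        push Not at hno
        exact hγS ⟨⟨by linarith, by linarith [hβ.2]⟩, Or.inr ⟨a, ha, N, fun m hm => hno m hm⟩⟩
      exact le_of_psum_not_le_rpow hM hm₀ hc₀ hcont hdiff hmono hnn hle hf0 hanti hineq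
        (by linarith) hγ2 hβ.2 hbad n
    -- let `γ ↓ βc`
    by_contra hcon
    push Not at hcon
    -- pick γ with c₀(β − γ) > f n β, i.e. γ < β − f n β / c₀, and γ > βc
    have h1 : f n β / c₀ < β - βc := by rw [div_lt_iff₀ hc₀]; linarith
    set γ : ℝ := (βc + (β - f n β / c₀)) / 2 with hγ
    have hγ1 : βc < γ := by rw [hγ]; linarith
    have hγ2 : γ < β := by
      rw [hγ]; have : 0 ≤ f n β / c₀ := div_nonneg (hnn n β) hc₀.le; linarith
    have h2 := key γ hγ1 hγ2
    have h3 : c₀ * (β - γ) > f n β := by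
      rw [hγ]
      have : c₀ * (β - (βc + (β - f n β / c₀)) / 2) = (c₀ * (β - βc) + f n β) / 2 := by field_simp; ring
      rw [this]; linarith
    linarith

end Main

end DRTLemma

end Literature.Probability.Percolation
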